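import Mathlib.FieldTheory.Fixed
import Mathlib
import HarnessLib

/-!
# Route `PrintCf2`, crux stmt-BirchSwinnertonDyer-20509 `RamifiedOffTYZOfFacts`, THEOREM A's target (T1): TRANSPORT OF ORBIT PRODUCTS through a common
# overfield — two finite Galois actions `N ↷ F₁`, `G ↷ F₂` whose fixed fields have the same image in `Ω` and elements `x₀ ↦ X₀ ↤ a₀` give conjugate
# sets with the same image: `j(∏_{N•x₀} x) = e(∏_{G•a₀} a)` and `#N•x₀ = #G•a₀`
# (cell `bsd-print-cf2`, LEAD cruxlead-20509 g33, line `offtyz-v7`, lineage cycle 34; fact-free, Theses-free, `def`-free, number-field-free)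

HONEST FRAMING (`--supports stmt-BirchSwinnertonDyer-20509`; theorems only, no `sorry`, no new named fact).  BSD is not proved by any of this;
no class is closed by this file; item 23431 (C⁺) and crux 20509 stay OPEN.  Target (T1) of THEOREM A's road (`TheoremATargets.orbitProd_sq_of_targets`,
p812073: hypothesis `hT1 : j Q = e (∏ x ∈ univ.image (· • (s₀*s₀)), x)` with `Q = ∏ x ∈ univ.image (· • x₀), x`).  For THEOREM A: `F₁ = M` (the
realisation, `N` the automorphisms trivial on `ι L_n(i)`), `F₂ = K^{(32)}` (`G = Gal(K^{(32)}/L₁)`), `Ω = ℂ`, `x₀` the abstract CM value, `a₀ = s₀²`,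
`j x₀ = X(τ) = e a₀` (`TheoremAField`, p811823).  The proof is the classical one: both `∏_{y ∈ N•x₀} (X − j y)` and `∏_{b ∈ G•a₀} (X − e b)` are the
minimal polynomial of `X₀ = j x₀ = e a₀` over the common subfield `j(F₁^N) = e(F₂^G)` of `Ω` (Artin: `F₁^N(x₀)`'s minimal polynomial is
`∏_{N•x₀}(X − y)`, Mathlib `FixedPoints.minpoly`).

* `prod_image_smul_eq_prod_quotient` / `card_image_smul_eq` — the orbit as `univ.image (· • x)` against `G ⧸ Stab`;
* `map_prodXSubSMul` — `(∏_{N•x}(X − y)).map j = ∏_{N•x} (X − C (j y))`; its degree and its value at `0`;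
* ★ `map_prodXSubSMul_eq_of_range_eq` — **the two characteristic polynomials have the same image in `Ω[X]`**;
* ★★ `map_prod_orbit_eq_of_range_eq` — **`j (∏_{y ∈ N•x₀} y) = e (∏_{b ∈ G•a₀} b)`**; `card_orbit_eq_of_range_eq` — **`#N•x₀ = #G•a₀`**.

References: E. Artin, Galois theory (fixed fields) [folklore]; [cite: NeukirchSchmidtWingberg2008, §1.5]; Mathlib `FieldTheory.Fixed`; tree p812073.
-/

noncomputable section

open scoped Classical Polynomial

namespace Summit.BirchSwinnertonDyer.PrintCf2.TheoremATransport

open MulAction Finset Polynomial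

variable {F : Type*} [Field F] {Ω : Type*} [Field Ω] (G : Type*) [Group G] [Fintype G] [MulSemiringAction G F]

/-! ## §1 The orbit as a `Finset` image and as `G ⧸ Stab` -/

/-- `univ.image (· • x)` is the image of `G ⧸ Stab_G(x)` under the orbit map. [folklore] -/
theorem image_smul_eq_image_ofQuotientStabilizer (x : F) :
    (univ : Finset G).image (fun g => g • x) = (univ : Finset (G ⧸ stabilizer G x)).image (ofQuotientStabilizer G x) := by
  ext y
  simp only [mem_image, mem_univ, true_and]
  constructor
  · rintro ⟨g, rfl⟩; exact ⟨QuotientGroup.mk g, ofQuotientStabilizer_mk G x g⟩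
  · rintro ⟨c, rfl⟩
    obtain ⟨g, rfl⟩ := QuotientGroup.mk_surjective c
    exact ⟨g, (ofQuotientStabilizer_mk G x g).symm⟩

/-- `∏_{y ∈ G•x} y = ∏_{c ∈ G/Stab} c•x`. [folklore] -/
theorem prod_image_smul_eq_prod_quotient (x : F) :
    ∏ y ∈ (univ : Finset G).image (fun g => g • x), y = ∏ c : G ⧸ stabilizer G x, ofQuotientStabilizer G x c := by
  rw [image_smul_eq_image_ofQuotientStabilizer, prod_image fun c₁ _ c₂ _ h => injective_ofQuotientStabilizer G x h]

/-- `#(G•x) = #(G/Stab)`. [folklore] -/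
theorem card_image_smul_eq (x : F) : ((univ : Finset G).image (fun g => g • x)).card = Fintype.card (G ⧸ stabilizer G x) := by
  rw [image_smul_eq_image_ofQuotientStabilizer, card_image_of_injective _ (injective_ofQuotientStabilizer G x), card_univ]

/-! ## §2 The characteristic polynomial of the orbit, mapped to `Ω` -/

/-- `(∏_{c ∈ G/Stab} (X − C (c•x))).map j = ∏_{c} (X − C (j (c•x)))`. [folklore] -/
theorem map_prodXSubSMul (j : F →+* Ω) (x : F) :
    (prodXSubSMul G F x).map j = ∏ c : G ⧸ stabilizer G x, (X - C (j (ofQuotientStabilizer G x c))) := by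
  rw [prodXSubSMul, Polynomial.map_prod]
  refine Finset.prod_congr rfl fun c _ => ?_
  rw [Polynomial.map_sub, map_X, map_C]

/-- Degree of the mapped characteristic polynomial: `#(G•x)`. [folklore] -/
theorem natDegree_map_prodXSubSMul (j : F →+* Ω) (x : F) :
    ((prodXSubSMul G F x).map j).natDegree = ((univ : Finset G).image (fun g => g • x)).card := by
  rw [map_prodXSubSMul, natDegree_prod_of_monic _ _ fun c _ => monic_X_sub_C _, card_image_smul_eq G x, ← card_univ]
  simp only [natDegree_X_sub_C, sum_const, smul_eq_mul, mul_one]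

/-- Value at `0` of the mapped characteristic polynomial: `(−1)^{#G•x} · j(∏_{G•x} y)`. [folklore] -/
theorem eval_zero_map_prodXSubSMul (j : F →+* Ω) (x : F) :
    ((prodXSubSMul G F x).map j).eval 0 =
      (-1) ^ ((univ : Finset G).image (fun g => g • x)).card * j (∏ y ∈ (univ : Finset G).image (fun g => g • x), y) := by
  rw [map_prodXSubSMul, eval_prod, prod_image_smul_eq_prod_quotient, map_prod, card_image_smul_eq G x, ← card_univ, ← prod_const,
    ← prod_mul_distrib]
  refine Finset.prod_congr rfl fun c _ => ?_
  rw [eval_sub, eval_X, eval_C]; ring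

/-- The mapped characteristic polynomial is the image of Artin's minimal polynomial over the fixed field. [folklore] -/
theorem map_prodXSubSMul_eq_map_minpoly (j : F →+* Ω) (x : F) :
    (prodXSubSMul G F x).map j = (FixedPoints.minpoly G F x).map (j.comp (FixedPoints.subfield G F).subtype) := by
  have h : (FixedPoints.minpoly G F x).map (FixedPoints.subfield G F).subtype = prodXSubSMul G F x := by
    rw [FixedPoints.minpoly, ← Subfield.toSubring_subtype_eq_subtype, Polynomial.map_toSubring]
  rw [← Polynomial.map_map, h]

/-- The mapped characteristic polynomial vanishes at `j x`. [folklore] -/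
theorem eval_map_prodXSubSMul_self (j : F →+* Ω) (x : F) : ((prodXSubSMul G F x).map j).eval (j x) = 0 := by
  rw [eval_map, eval₂_hom, prodXSubSMul.eval, map_zero]

/-! ## §3 Transport: two actions, one overfield -/

variable {F' : Type*} [Field F'] (G' : Type*) [Group G'] [Fintype G'] [MulSemiringAction G' F']

/-- One divisibility: if the fixed field of `G'` maps INTO the image of the fixed field of `G`, and `j x = e a`, then the (mapped) characteristic
polynomial of `G•x` divides that of `G'•a` (lift the latter to `F^G[X]`; it kills `x`; Artin's minimal polynomial divides it). [folklore] -/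
theorem map_prodXSubSMul_dvd_of_range_le (j : F →+* Ω) (e : F' →+* Ω) (x : F) (a : F') (hxa : j x = e a)
    (hrange : ∀ r : F', (∀ g : G', g • r = r) → ∃ m : F, (∀ g : G, g • m = m) ∧ j m = e r) :
    (prodXSubSMul G F x).map j ∣ (prodXSubSMul G' F' a).map e := by
  set k := FixedPoints.subfield G F with hk
  set φ : k →+* Ω := j.comp k.subtype with hφ
  -- the target lifts to `k[X]`
  have hlift : (prodXSubSMul G' F' a).map e ∈ Polynomial.lifts φ := by
    rw [lifts_iff_coeff_lifts]
    intro n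
    rw [coeff_map]
    have hfix : ∀ g : G', g • (prodXSubSMul G' F' a).coeff n = (prodXSubSMul G' F' a).coeff n := fun g => prodXSubSMul.coeff G' F' a g n
    obtain ⟨m, hm, hjm⟩ := hrange _ hfix
    exact ⟨⟨m, hm⟩, hjm⟩
  obtain ⟨q, hq⟩ := (mem_lifts _).mp hlift
  -- `q(x) = 0`, so Artin's minimal polynomial divides `q`
  have hqx : Polynomial.eval₂ k.subtype x q = 0 := by
    apply j.injective
    rw [hom_eval₂, map_zero, ← hφ, ← eval_map, hq, hxa, eval_map, eval₂_hom, prodXSubSMul.eval, map_zero]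
  have hdvd := FixedPoints.minpoly.of_eval₂ G F x q hqx
  rw [map_prodXSubSMul_eq_map_minpoly, ← hq]
  exact Polynomial.map_dvd φ hdvd

/-- ★ **Equal characteristic polynomials.**  If the fixed fields `F^G` and `F'^{G'}` have the SAME image in `Ω` (under `j`, `e`) and `j x = e a`, then
`(∏_{G•x}(X − y)).map j = (∏_{G'•a}(X − b)).map e` (both are the minimal polynomial of `j x` over the common subfield). [folklore]
[cite: NeukirchSchmidtWingberg2008, §1.5] -/
theorem map_prodXSubSMul_eq_of_range_eq (j : F →+* Ω) (e : F' →+* Ω) (x : F) (a : F') (hxa : j x = e a)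
    (h₁ : ∀ r : F', (∀ g : G', g • r = r) → ∃ m : F, (∀ g : G, g • m = m) ∧ j m = e r)
    (h₂ : ∀ m : F, (∀ g : G, g • m = m) → ∃ r : F', (∀ g : G', g • r = r) ∧ e r = j m) :
    (prodXSubSMul G F x).map j = (prodXSubSMul G' F' a).map e :=
  eq_of_monic_of_associated ((prodXSubSMul.monic G F x).map j) ((prodXSubSMul.monic G' F' a).map e)
    (associated_of_dvd_dvd (map_prodXSubSMul_dvd_of_range_le G G' j e x a hxa h₁)
      (map_prodXSubSMul_dvd_of_range_le G' G e j a x hxa.symm h₂))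

/-- ★★ **`#G•x = #G'•a`** under the hypotheses of `map_prodXSubSMul_eq_of_range_eq`. [folklore] -/
theorem card_orbit_eq_of_range_eq (j : F →+* Ω) (e : F' →+* Ω) (x : F) (a : F') (hxa : j x = e a)
    (h₁ : ∀ r : F', (∀ g : G', g • r = r) → ∃ m : F, (∀ g : G, g • m = m) ∧ j m = e r)
    (h₂ : ∀ m : F, (∀ g : G, g • m = m) → ∃ r : F', (∀ g : G', g • r = r) ∧ e r = j m) :
    ((univ : Finset G).image (fun g => g • x)).card = ((univ : Finset G').image (fun g => g • a)).card := by
  rw [← natDegree_map_prodXSubSMul G j x, ← natDegree_map_prodXSubSMul G' e a, map_prodXSubSMul_eq_of_range_eq G G' j e x a hxa h₁ h₂]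

/-- ★★ **TRANSPORT OF ORBIT PRODUCTS: `j (∏_{y ∈ G•x} y) = e (∏_{b ∈ G'•a} b)`** under the hypotheses of `map_prodXSubSMul_eq_of_range_eq` — target (T1)
of THEOREM A. [folklore] [cite: NeukirchSchmidtWingberg2008, §1.5] -/
theorem map_prod_orbit_eq_of_range_eq [CharZero Ω] (j : F →+* Ω) (e : F' →+* Ω) (x : F) (a : F') (hxa : j x = e a)
    (h₁ : ∀ r : F', (∀ g : G', g • r = r) → ∃ m : F, (∀ g : G, g • m = m) ∧ j m = e r)
    (h₂ : ∀ m : F, (∀ g : G, g • m = m) → ∃ r : F', (∀ g : G', g • r = r) ∧ e r = j m) :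
    j (∏ y ∈ (univ : Finset G).image (fun g => g • x), y) = e (∏ b ∈ (univ : Finset G').image (fun g => g • a), b) := by
  have hpoly := map_prodXSubSMul_eq_of_range_eq G G' j e x a hxa h₁ h₂
  have hcard := card_orbit_eq_of_range_eq G G' j e x a hxa h₁ h₂
  have h0 := congrArg (Polynomial.eval 0) hpoly
  rw [eval_zero_map_prodXSubSMul, eval_zero_map_prodXSubSMul, hcard] at h0
  exact mul_left_cancel₀ (pow_ne_zero _ (neg_ne_zero.mpr one_ne_zero)) h0

end Summit.BirchSwinnertonDyer.PrintCf2.TheoremATransport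

end
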